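import Summits.CriticalPhenomena.SAWScalingLimit.Theorems.SAWReversalUpgradeAttachNoReturnPolyline
import Literature.Probability.LatticeModels.MedialCycleTurning
import Literature.Probability.Percolation.LatticeTraceGeometry
import HarnessLib

/-!
# Self-avoiding lattice polylines have no sub-mesh fjords

Support file for crux stmt-CriticalPhenomena-1372 `EventualTight` (bet route `SAWWeldingIdentification`, line `Sketch`,
lead c9): the deterministic input of the rung `NoReturnTight → NoReturnTightU → EventualTight`
(`Theorems/SAWWeldingIdentificationEventualTightOfNoFjord.lean`).  The `(ε, ℓ)`-return event of the no-return
strengthenings (strategists b1/s3) — times `s < t < u` with `dist (P s) (P u) ≤ ε`, `ℓ ≤ dist (P s) (P t)` along the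
mesh-`δ` SAW polyline `P` — is EMPTY when `ε < δ`, `ε < ℓ` (registered stub `sawPolyline_noSubmeshFjord`): two points
of `P` at distance `< δ` lie on one edge or on consecutive edges (vertex-disjoint edges of `ℤ²` are `≥ 1` apart,
`one_le_dist_of_mem_segment_of_mem_segment`), where the distance from the first point is monotone (`turn_of_units`,
`dist_uniform_le_of_dist_lt` over the uniform clock of `Theorems.AttachNoReturn`). [cite: AizenmanBurchardDuke1999, §2.d]
-/

noncomputable section

open Set Metric
open Literature.Probability.LatticeModels Literature.Probability.RandomPlanarGeometry

namespace Summit.CriticalPhenomena.SAWScalingLimit.Theorems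

namespace NoSubmeshFjord

/-- Coordinates of a point of the lattice edge `[a, a + eᵢ]`: the `i`-th moves by `t ∈ [0, 1]`, the other stays. [folklore] -/
theorem exists_re_im_of_mem_segment_single {a : Site 2} (i : Fin 2) {p : ℂ}
    (hp : p ∈ segment ℝ (Site.toComplex a) (Site.toComplex (a + Pi.single i 1))) :
    ∃ t : ℝ, 0 ≤ t ∧ t ≤ 1 ∧
      p.re = a 0 + (if i = 0 then t else 0) ∧ p.im = a 1 + (if i = 1 then t else 0) := by
  rw [segment_eq_image'] at hp
  obtain ⟨t, ⟨ht0, ht1⟩, rfl⟩ := hp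
  refine ⟨t, ht0, ht1, ?_, ?_⟩ <;> fin_cases i <;> simp [Site.toComplex]

/-- **Two vertex-disjoint lattice edges are `≥ 1` apart** (oriented form: `[a, a + eᵢ]`, `[c, c + eⱼ]`). [folklore] -/
theorem one_le_dist_of_mem_segment_single_single {a c : Site 2} (i j : Fin 2)
    (hca : c ≠ a) (hcb : c ≠ a + Pi.single i 1) (hda : c + Pi.single j 1 ≠ a)
    (hdb : c + Pi.single j 1 ≠ a + Pi.single i 1) {p q : ℂ}
    (hp : p ∈ segment ℝ (Site.toComplex a) (Site.toComplex (a + Pi.single i 1)))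
    (hq : q ∈ segment ℝ (Site.toComplex c) (Site.toComplex (c + Pi.single j 1))) :
    1 ≤ dist p q := by
  have site_ext : ∀ {x y : Site 2}, x 0 = y 0 → x 1 = y 1 → x = y :=
    fun h0 h1 => by funext k; fin_cases k <;> assumption
  obtain ⟨t, ht0, ht1, hpre, hpim⟩ := exists_re_im_of_mem_segment_single i hp
  obtain ⟨s, hs0, hs1, hqre, hqim⟩ := exists_re_im_of_mem_segment_single j hq
  rw [dist_eq_norm]
  suffices h : 1 ≤ |(p - q).re| ∨ 1 ≤ |(p - q).im| by
    rcases h with h | h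
    · exact h.trans (Complex.abs_re_le_norm _)
    · exact h.trans (Complex.abs_im_le_norm _)
  rw [Complex.sub_re, Complex.sub_im, hpre, hpim, hqre, hqim]
  have e0 : ∀ (x : Site 2) (k : Fin 2), (x + Pi.single k 1 : Site 2) 0 = x 0 + (if k = 0 then 1 else 0) := by
    intro x k; fin_cases k <;> simp
  have e1 : ∀ (x : Site 2) (k : Fin 2), (x + Pi.single k 1 : Site 2) 1 = x 1 + (if k = 1 then 1 else 0) := by
    intro x k; fin_cases k <;> simp
  have nca : ¬ (c 0 = a 0 ∧ c 1 = a 1) := fun h => hca (site_ext h.1 h.2)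
  have ncb : ¬ (c 0 = (a + Pi.single i 1 : Site 2) 0 ∧ c 1 = (a + Pi.single i 1 : Site 2) 1) :=
    fun h => hcb (site_ext h.1 h.2)
  have nda : ¬ ((c + Pi.single j 1 : Site 2) 0 = a 0 ∧ (c + Pi.single j 1 : Site 2) 1 = a 1) :=
    fun h => hda (site_ext h.1 h.2)
  have ndb : ¬ ((c + Pi.single j 1 : Site 2) 0 = (a + Pi.single i 1 : Site 2) 0 ∧
      (c + Pi.single j 1 : Site 2) 1 = (a + Pi.single i 1 : Site 2) 1) := fun h => hdb (site_ext h.1 h.2)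
  rw [e0, e1] at ncb nda ndb; rw [e0, e1] at ndb
  fin_cases i <;> fin_cases j <;>
    simp only [Fin.zero_eta, Fin.mk_one, Fin.isValue, if_true, one_ne_zero, zero_ne_one, if_false,
      add_zero] at ncb nda ndb ⊢
  · by_cases h1 : c 1 = a 1
    · left
      rcases (show c 0 ≤ a 0 - 2 ∨ a 0 + 2 ≤ c 0 by omega) with h | h
      · have : (c 0 : ℝ) ≤ a 0 - 2 := by exact_mod_cast h
        rw [le_abs]; left; linarith
      · have : (a 0 : ℝ) + 2 ≤ c 0 := by exact_mod_cast h
        rw [le_abs]; right; linarith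
    · right
      have : (1 : ℝ) ≤ |((a 1 - c 1 : ℤ) : ℝ)| := by exact_mod_cast Int.one_le_abs (sub_ne_zero.2 (Ne.symm h1))
      push_cast at this
      simpa using this
  · by_cases h0 : c 0 = a 0 ∨ c 0 = a 0 + 1
    · right
      rcases (show a 1 - c 1 ≥ 2 ∨ a 1 - c 1 ≤ -1 by omega) with h | h
      · have : (2 : ℝ) ≤ a 1 - c 1 := by exact_mod_cast h
        rw [le_abs]; left; linarith
      · have : (a 1 : ℝ) - c 1 ≤ -1 := by exact_mod_cast h
        rw [le_abs]; right; linarith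
    · left
      rcases (show c 0 ≤ a 0 - 1 ∨ a 0 + 2 ≤ c 0 by omega) with h | h
      · have : (c 0 : ℝ) ≤ a 0 - 1 := by exact_mod_cast h
        rw [le_abs]; left; linarith
      · have : (a 0 : ℝ) + 2 ≤ c 0 := by exact_mod_cast h
        rw [le_abs]; right; linarith
  · by_cases h1 : c 1 = a 1 ∨ c 1 = a 1 + 1
    · left
      rcases (show a 0 - c 0 ≥ 2 ∨ a 0 - c 0 ≤ -1 by omega) with h | h
      · have : (2 : ℝ) ≤ a 0 - c 0 := by exact_mod_cast h
        rw [le_abs]; left; linarith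
      · have : (a 0 : ℝ) - c 0 ≤ -1 := by exact_mod_cast h
        rw [le_abs]; right; linarith
    · right
      rcases (show c 1 ≤ a 1 - 1 ∨ a 1 + 2 ≤ c 1 by omega) with h | h
      · have : (c 1 : ℝ) ≤ a 1 - 1 := by exact_mod_cast h
        rw [le_abs]; left; linarith
      · have : (a 1 : ℝ) + 2 ≤ c 1 := by exact_mod_cast h
        rw [le_abs]; right; linarith
  · by_cases h0 : c 0 = a 0
    · right
      rcases (show c 1 ≤ a 1 - 2 ∨ a 1 + 2 ≤ c 1 by omega) with h | h
      · have : (c 1 : ℝ) ≤ a 1 - 2 := by exact_mod_cast h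
        rw [le_abs]; left; linarith
      · have : (a 1 : ℝ) + 2 ≤ c 1 := by exact_mod_cast h
        rw [le_abs]; right; linarith
    · left
      have : (1 : ℝ) ≤ |((a 0 - c 0 : ℤ) : ℝ)| := by exact_mod_cast Int.one_le_abs (sub_ne_zero.2 (Ne.symm h0))
      push_cast at this
      simpa using this


/-- **Two vertex-disjoint lattice edges are `≥ 1` apart**: if `a ∼ b`, `c ∼ d` in `ℤ²` and `{c, d} ∩ {a, b} = ∅`,
every point of `[a, b]` is at distance `≥ 1` from every point of `[c, d]`. [folklore] -/
theorem one_le_dist_of_mem_segment_of_mem_segment {a b c d : Site 2} (hab : (zdGraph 2).Adj a b)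
    (hcd : (zdGraph 2).Adj c d) (hca : c ≠ a) (hcb : c ≠ b) (hda : d ≠ a) (hdb : d ≠ b) {p q : ℂ}
    (hp : p ∈ segment ℝ (Site.toComplex a) (Site.toComplex b))
    (hq : q ∈ segment ℝ (Site.toComplex c) (Site.toComplex d)) : 1 ≤ dist p q := by
  obtain ⟨i, hi⟩ := (zdGraph_adj_iff a b).1 hab
  obtain ⟨j, hj⟩ := (zdGraph_adj_iff c d).1 hcd
  have key : ∀ {a₀ c₀ : Site 2}, c₀ ≠ a₀ → c₀ ≠ a₀ + Pi.single i 1 → c₀ + Pi.single j 1 ≠ a₀ →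
      c₀ + Pi.single j 1 ≠ a₀ + Pi.single i 1 →
      p ∈ segment ℝ (Site.toComplex a₀) (Site.toComplex (a₀ + Pi.single i 1)) →
      q ∈ segment ℝ (Site.toComplex c₀) (Site.toComplex (c₀ + Pi.single j 1)) → 1 ≤ dist p q :=
    fun h1 h2 h3 h4 hp' hq' => one_le_dist_of_mem_segment_single_single i j h1 h2 h3 h4 hp' hq'
  rcases hi with rfl | rfl <;> rcases hj with rfl | rfl
  · exact key hca hcb hda hdb hp hq
  · rw [segment_symm] at hq
    exact key hda hdb hca hcb hp hq
  · rw [segment_symm] at hp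
    exact key hcb hca hdb hda hp hq
  · rw [segment_symm] at hp hq
    exact key hdb hda hcb hca hp hq

/-- A lattice step, read in `ℂ`, is one of the four units `±1, ±I`. [folklore] -/
theorem toComplex_sub_of_adj {x y : Site 2} (h : (zdGraph 2).Adj x y) :
    Site.toComplex y - Site.toComplex x = 1 ∨ Site.toComplex y - Site.toComplex x = -1 ∨
      Site.toComplex y - Site.toComplex x = Complex.I ∨ Site.toComplex y - Site.toComplex x = -Complex.I := by
  obtain ⟨i, rfl | rfl⟩ := (zdGraph_adj_iff x y).1 h
  · rw [Literature.Probability.Percolation.toComplex_add, add_sub_cancel_left]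
    fin_cases i
    · exact Or.inl LSWGrid.toComplex_single_zero
    · exact Or.inr (Or.inr (Or.inl LSWGrid.toComplex_single_one))
  · rw [Literature.Probability.Percolation.toComplex_add, sub_add_cancel_left]
    fin_cases i
    · refine Or.inr (Or.inl ?_)
      simp only [Fin.zero_eta, Fin.isValue, neg_inj]
      exact LSWGrid.toComplex_single_zero
    · refine Or.inr (Or.inr (Or.inr ?_))
      simp only [Fin.mk_one, Fin.isValue, neg_inj]
      exact LSWGrid.toComplex_single_one

/-- **No back-tracking means a non-obtuse turn**: for lattice steps `d₁, d₂ ∈ {±1, ±I}` with `d₁ + d₂ ≠ 0` the turn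
`w = d₂ · conj d₁` has `Re w ≥ 0`, `d₂ = w · d₁` and `‖d₁‖ = 1`. [folklore] -/
theorem turn_of_units {d₁ d₂ : ℂ}
    (h₁ : d₁ = 1 ∨ d₁ = -1 ∨ d₁ = Complex.I ∨ d₁ = -Complex.I)
    (h₂ : d₂ = 1 ∨ d₂ = -1 ∨ d₂ = Complex.I ∨ d₂ = -Complex.I) (hne : d₁ + d₂ ≠ 0) :
    0 ≤ (d₂ * (starRingEnd ℂ) d₁).re ∧ d₂ = (d₂ * (starRingEnd ℂ) d₁) * d₁ ∧ ‖d₁‖ = 1 := by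
  rcases h₁ with rfl | rfl | rfl | rfl <;> rcases h₂ with rfl | rfl | rfl | rfl <;>
    norm_num [Complex.ext_iff] at hne <;>
    norm_num [Complex.ext_iff, Complex.conj_I, Complex.I_mul_I, Complex.norm_I]

/-- Monotonicity of `y ↦ ‖α + y·w‖` on `[0, ∞)` for `α ≥ 0` and `Re w ≥ 0`. [folklore] -/
theorem norm_add_mul_mono {α : ℝ} (hα : 0 ≤ α) {w : ℂ} (hw : 0 ≤ w.re) {y z : ℝ} (hy : 0 ≤ y)
    (hyz : y ≤ z) : ‖(α : ℂ) + y * w‖ ≤ ‖(α : ℂ) + z * w‖ := by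
  have hz : 0 ≤ z := hy.trans hyz
  rw [← Real.sqrt_sq (norm_nonneg _), ← Real.sqrt_sq (norm_nonneg ((α : ℂ) + z * w))]
  refine Real.sqrt_le_sqrt ?_
  rw [Complex.sq_norm, Complex.sq_norm, Complex.normSq_apply, Complex.normSq_apply]
  simp only [Complex.add_re, Complex.ofReal_re, Complex.mul_re, Complex.ofReal_im, zero_mul, sub_zero,
    Complex.add_im, Complex.mul_im, add_zero, zero_add]
  have h1 : α + y * w.re ≤ α + z * w.re := by nlinarith
  have h2 : 0 ≤ α + y * w.re := by positivity
  have h3 : (y * w.im) * (y * w.im) ≤ (z * w.im) * (z * w.im) := by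
    calc (y * w.im) * (y * w.im) = y ^ 2 * w.im ^ 2 := by ring
      _ ≤ z ^ 2 * w.im ^ 2 := by gcongr
      _ = (z * w.im) * (z * w.im) := by ring
  nlinarith

/-! ### No sub-mesh fjords along the polyline of a self-avoiding walk -/

section Saw

open Literature.Probability.RandomPlanarGeometry Literature.Probability.RandomPlanarGeometry.Polyline
open Summit.CriticalPhenomena.SAWScalingLimit.Theorems.AttachNoReturn

variable {Ω : Set ℂ} {δ : ℝ} {a b : Site 2}

/-- **No sub-mesh fjords, uniform clock.** Along the uniform polyline `U` of a self-avoiding walk of `δℤ²` (`δ > 0`),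
times `0 ≤ σ ≤ τ ≤ ρ ≤ length` with `dist (U σ) (U ρ) < δ` have `dist (U σ) (U τ) ≤ dist (U σ) (U ρ)`: the two points
lie on one edge or on consecutive edges, where the distance from the first point is monotone. [folklore] -/
theorem dist_uniform_le_of_dist_lt (hδ : 0 < δ) (γ : SAW.DomainSAW Ω δ a b) {σ τ ρ : ℝ} (h0 : 0 ≤ σ)
    (hστ : σ ≤ τ) (hτρ : τ ≤ ρ) (hρ : ρ ≤ γ.walk.length)
    (hlt : dist (uniform (meshPoint δ a) (γ.walk.support.map (meshPoint δ)).tail σ)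
      (uniform (meshPoint δ a) (γ.walk.support.map (meshPoint δ)).tail ρ) < δ) :
    dist (uniform (meshPoint δ a) (γ.walk.support.map (meshPoint δ)).tail σ)
        (uniform (meshPoint δ a) (γ.walk.support.map (meshPoint δ)).tail τ) ≤
      dist (uniform (meshPoint δ a) (γ.walk.support.map (meshPoint δ)).tail σ)
        (uniform (meshPoint δ a) (γ.walk.support.map (meshPoint δ)).tail ρ) := by
  set n := γ.walk.length
  set U := uniform (meshPoint δ a) (γ.walk.support.map (meshPoint δ)).tail with hU
  set p : ℕ → ℂ := fun k => meshPoint δ (γ.walk.getVert k) with hp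
  rcases Nat.eq_zero_or_pos n with hn0 | hn0
  · -- no edge: `U` is constant
    have htail : (γ.walk.support.map (meshPoint δ)).tail = [] :=
      List.eq_nil_of_length_eq_zero (by rw [length_tail_map_support]; exact hn0)
    have hconst : ∀ s, U s = meshPoint δ a := fun s => by rw [hU, htail, uniform_nil]
    simp [hconst]
  -- vertices are distinct (self-avoidance) and consecutive ones are adjacent in `ℤ²`
  have hvinj : ∀ k m, k ≤ n → m ≤ n → γ.walk.getVert k = γ.walk.getVert m → k = m :=
    fun k m hk hm h => γ.isPath.getVert_injOn (by exact hk) (by exact hm) h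
  have hadj : ∀ k, k < n → (zdGraph 2).Adj (γ.walk.getVert k) (γ.walk.getVert (k + 1)) :=
    fun k hk => zd_adj_of_adj (γ.walk.adj_getVert_succ hk)
  have hdist : ∀ k, k < n → dist (p k) (p (k + 1)) = δ :=
    fun k hk => dist_meshPoint_getVert_succ hδ γ hk
  have hUseg : ∀ k, k < n → ∀ s ∈ Icc (0 : ℝ) 1, U (k + s) = AffineMap.lineMap (p k) (p (k + 1)) s :=
    fun k hk s hs => uniform_walk_apply_add (meshPoint δ) γ.walk hk hs
  have hdec : ∀ σ ∈ Icc (0 : ℝ) n, ∃ (i : ℕ) (s : ℝ), i < n ∧ s ∈ Icc (0 : ℝ) 1 ∧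
      σ = i + s ∧ (s < 1 ∨ σ = n) ∧ (σ < n → i = ⌊σ⌋₊) := by
    intro σ hσ
    rcases eq_or_lt_of_le hσ.2 with h | h
    · refine ⟨n - 1, 1, by omega, ⟨zero_le_one, le_rfl⟩, ?_, Or.inr h, fun h' => absurd h h'.ne⟩
      rw [h, Nat.cast_sub hn0]
      push_cast
      ring
    · refine ⟨⌊σ⌋₊, σ - ⌊σ⌋₊, (Nat.floor_lt hσ.1).2 h, ⟨?_, ?_⟩, by ring, Or.inl ?_, fun _ => rfl⟩
      · linarith [Nat.floor_le hσ.1]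
      · linarith [Nat.lt_floor_add_one σ]
      · linarith [Nat.lt_floor_add_one σ]
  have hmono : ∀ {σ₁ σ₂ : ℝ} {i₁ i₂ : ℕ} {s₁ s₂ : ℝ}, σ₁ ≤ σ₂ → i₁ < n → σ₁ = i₁ + s₁ →
      (σ₁ < n → i₁ = ⌊σ₁⌋₊) → i₂ < n → s₂ ∈ Icc (0 : ℝ) 1 → σ₂ = i₂ + s₂ → (s₂ < 1 ∨ σ₂ = n) →
      (σ₂ < n → i₂ = ⌊σ₂⌋₊) → i₁ ≤ i₂ := by
    intro σ₁ σ₂ i₁ i₂ s₁ s₂ hle hi₁ hσ₁ hfl₁ hi₂ hs₂ hσ₂ hs₂1 hfl₂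
    rcases hs₂1 with hlt₂ | heq₂
    · have h2 : σ₂ < n := by
        have : (i₂ : ℝ) + 1 ≤ n := by exact_mod_cast hi₂
        linarith
      have h1 : σ₁ < n := lt_of_le_of_lt hle h2
      rw [hfl₁ h1, hfl₂ h2]; exact Nat.floor_mono hle
    · have h3 : (n : ℝ) ≤ (i₂ : ℝ) + 1 := by linarith [hs₂.2]
      have h4 : n ≤ i₂ + 1 := by exact_mod_cast h3
      omega
  obtain ⟨i, x, hi, hx, hσx, -, hflσ⟩ := hdec σ ⟨h0, hστ.trans (hτρ.trans hρ)⟩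
  obtain ⟨j, y, hj, hy, hτy, hy1, hflτ⟩ := hdec τ ⟨h0.trans hστ, hτρ.trans hρ⟩
  obtain ⟨k, z, hk, hz, hρz, hz1, hflρ⟩ := hdec ρ ⟨h0.trans (hστ.trans hτρ), hρ⟩
  have hij : i ≤ j := hmono hστ hi hσx hflσ hj hy hτy hy1 hflτ
  have hjk : j ≤ k := hmono hτρ hj hτy hflτ hk hz hρz hz1 hflρ
  have hUσ : U σ = AffineMap.lineMap (p i) (p (i + 1)) x := by rw [hσx]; exact hUseg i hi x hx
  have hUτ : U τ = AffineMap.lineMap (p j) (p (j + 1)) y := by rw [hτy]; exact hUseg j hj y hy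
  have hUρ : U ρ = AffineMap.lineMap (p k) (p (k + 1)) z := by rw [hρz]; exact hUseg k hk z hz
  have hzσ : U σ ∈ segment ℝ (p i) (p (i + 1)) := by
    rw [hUσ, segment_eq_image_lineMap]; exact ⟨x, hx, rfl⟩
  have hzρ : U ρ ∈ segment ℝ (p k) (p (k + 1)) := by
    rw [hUρ, segment_eq_image_lineMap]; exact ⟨z, hz, rfl⟩
  -- the far case `k ≥ i + 2` contradicts `dist < δ`
  by_cases hfar : i + 1 < k
  · exfalso
    have h1 := div_mem_segment_of_mem hδ.ne' hzσ
    have h2 := div_mem_segment_of_mem hδ.ne' hzρ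
    have hne : ∀ m m', m ≤ n → m' ≤ n → m ≠ m' → γ.walk.getVert m ≠ γ.walk.getVert m' :=
      fun m m' hm hm' hmm' h => hmm' (hvinj m m' hm hm' h)
    have hge := one_le_dist_of_mem_segment_of_mem_segment (hadj i hi) (hadj k hk)
      (hne k i (by omega) (by omega) (by omega)) (hne k (i + 1) (by omega) (by omega) (by omega))
      (hne (k + 1) i (by omega) (by omega) (by omega))
      (hne (k + 1) (i + 1) (by omega) (by omega) (by omega)) h1 h2
    have hscale : dist (U σ / δ) (U ρ / δ) = dist (U σ) (U ρ) / δ := by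
      rw [dist_eq_norm, dist_eq_norm, ← sub_div, norm_div, Complex.norm_real, Real.norm_of_nonneg hδ.le]
    rw [hscale, le_div_iff₀ hδ, one_mul] at hge
    exact (not_lt.2 hge) hlt
  by_cases hki : k = i
  · -- same edge `k = j = i`: affine parametrisation
    have hji : j = i := le_antisymm (hki ▸ hjk) hij
    rw [hki] at hUρ hρz
    rw [hji] at hUτ hτy
    obtain ⟨hxy, hyz⟩ : x ≤ y ∧ y ≤ z := ⟨by linarith, by linarith⟩
    rw [hUσ, hUτ, hUρ, dist_lineMap_lineMap, dist_lineMap_lineMap, hdist i hi, Real.dist_eq, Real.dist_eq,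
      abs_of_nonpos (by linarith), abs_of_nonpos (by linarith)]
    nlinarith
  · -- consecutive edges `k = i + 1`
    have hk1 : k = i + 1 := by omega
    rw [hk1] at hUρ hρz hk hjk
    set d₁ : ℂ := Site.toComplex (γ.walk.getVert (i + 1)) - Site.toComplex (γ.walk.getVert i) with hd₁
    set d₂ : ℂ := Site.toComplex (γ.walk.getVert (i + 1 + 1)) - Site.toComplex (γ.walk.getVert (i + 1))
      with hd₂
    have hu₁ : d₁ = 1 ∨ d₁ = -1 ∨ d₁ = Complex.I ∨ d₁ = -Complex.I := toComplex_sub_of_adj (hadj i hi)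
    have hu₂ : d₂ = 1 ∨ d₂ = -1 ∨ d₂ = Complex.I ∨ d₂ = -Complex.I := toComplex_sub_of_adj (hadj (i + 1) hk)
    have hsum : d₁ + d₂ ≠ 0 := by
      intro h
      have h' : Site.toComplex (γ.walk.getVert (i + 1 + 1)) = Site.toComplex (γ.walk.getVert i) := by
        have : d₁ + d₂ = Site.toComplex (γ.walk.getVert (i + 1 + 1)) - Site.toComplex (γ.walk.getVert i) := by
          rw [hd₁, hd₂]; ring
        rw [this] at h
        exact sub_eq_zero.1 h
      have := hvinj (i + 1 + 1) i hk (by omega) (toComplex_injective_site h')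
      omega
    obtain ⟨hwre, hd₂w, hnorm₁⟩ := turn_of_units hu₁ hu₂ hsum
    set w : ℂ := d₂ * (starRingEnd ℂ) d₁
    have hp₁ : p (i + 1) - p i = (δ : ℂ) * d₁ := by
      simp only [hp, hd₁, meshPoint]; ring
    have hp₂ : p (i + 1 + 1) - p (i + 1) = (δ : ℂ) * d₂ := by
      simp only [hp, hd₂, meshPoint]; ring
    have e1 : p i = p (i + 1) - (δ : ℂ) * d₁ := by rw [← hp₁]; ring
    have e2 : p (i + 1 + 1) = p (i + 1) + (δ : ℂ) * (w * d₁) := by rw [← hd₂w, ← hp₂]; ring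
    have hF : ∀ y' : ℝ, dist (U σ) (AffineMap.lineMap (p (i + 1)) (p (i + 1 + 1)) y') =
        δ * ‖((1 - x : ℝ) : ℂ) + y' * w‖ := by
      intro y'
      rw [hUσ, dist_eq_norm, AffineMap.lineMap_apply_module', AffineMap.lineMap_apply_module',
        Complex.real_smul, Complex.real_smul]
      have : (x : ℂ) * (p (i + 1) - p i) + p i - ((y' : ℂ) * (p (i + 1 + 1) - p (i + 1)) + p (i + 1)) =
          -(((δ : ℂ) * d₁) * (((1 - x : ℝ) : ℂ) + y' * w)) := by
        rw [e2, e1]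
        simp only [Complex.ofReal_sub, Complex.ofReal_one]
        ring
      rw [this, norm_neg, norm_mul, norm_mul, Complex.norm_real, Real.norm_of_nonneg hδ.le, hnorm₁, mul_one]
    have hFmono : ∀ {y₁ y₂ : ℝ}, 0 ≤ y₁ → y₁ ≤ y₂ →
        dist (U σ) (AffineMap.lineMap (p (i + 1)) (p (i + 1 + 1)) y₁) ≤
          dist (U σ) (AffineMap.lineMap (p (i + 1)) (p (i + 1 + 1)) y₂) := by
      intro y₁ y₂ h₁ h₁₂
      rw [hF, hF]
      exact mul_le_mul_of_nonneg_left (norm_add_mul_mono (by linarith [hx.2]) hwre h₁ h₁₂) hδ.le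
    by_cases hjk' : j = i + 1
    · -- `τ` on the next edge, before `ρ`
      rw [hjk'] at hUτ hτy
      have hyz : y ≤ z := by linarith
      rw [hUτ, hUρ]
      exact hFmono hy.1 hyz
    · -- `τ` on the same edge as `σ`, after it
      have hji : j = i := by omega
      rw [hji] at hUτ hτy
      have hxy : x ≤ y := by linarith
      calc dist (U σ) (U τ) = (y - x) * δ := by
            rw [hUσ, hUτ, dist_lineMap_lineMap, hdist i hi, Real.dist_eq, abs_of_nonpos (by linarith)]
            ring
        _ ≤ (1 - x) * δ := by nlinarith [hy.2]
        _ = dist (U σ) (AffineMap.lineMap (p (i + 1)) (p (i + 1 + 1)) (0 : ℝ)) := by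
            rw [hF 0, Complex.ofReal_zero, zero_mul, add_zero, Complex.norm_real,
              Real.norm_of_nonneg (by linarith [hx.2])]
            ring
        _ ≤ dist (U σ) (U ρ) := by
            rw [hUρ]
            exact hFmono le_rfl hz.1

/-- **No sub-mesh fjords (dyadic polyline)**: for `P = γ.walk.toCurve (meshPoint δ)` of a SAW of `Ω_δ` (`δ > 0`) and
`s ≤ t ≤ u` with `dist (P s) (P u) < δ`: `dist (P s) (P t) ≤ dist (P s) (P u)` (monotone dyadic clock). [folklore] -/
theorem dist_toCurve_le_of_dist_lt (hδ : 0 < δ) (γ : SAW.DomainSAW Ω δ a b) {s t u : unitInterval}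
    (hst : s ≤ t) (htu : t ≤ u)
    (hlt : dist (γ.walk.toCurve (meshPoint δ) s) (γ.walk.toCurve (meshPoint δ) u) < δ) :
    dist (γ.walk.toCurve (meshPoint δ) s) (γ.walk.toCurve (meshPoint δ) t) ≤
      dist (γ.walk.toCurve (meshPoint δ) s) (γ.walk.toCurve (meshPoint δ) u) := by
  simp only [toCurve_apply_eq_uniform_clock] at hlt ⊢
  have hmem : ∀ r : unitInterval, clock γ.walk.length r ∈ Icc (0 : ℝ) γ.walk.length :=
    fun r => clock_mem_Icc _ ⟨r.2.1, r.2.2⟩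
  exact dist_uniform_le_of_dist_lt hδ γ (hmem s).1 (monotone_clock _ (Subtype.coe_le_coe.2 hst))
    (monotone_clock _ (Subtype.coe_le_coe.2 htu)) (hmem u).2 hlt

/-- **Self-avoiding lattice polylines have no sub-mesh fjords**: for `ε < δ` and `ε < ℓ` no times `s < t < u` have
`dist (P s) (P u) ≤ ε` and `ℓ ≤ dist (P s) (P t)` — the `(ε, ℓ)`-return event is EMPTY at every mesh `δ > ε`. [folklore] -/
theorem not_exists_fjord_of_lt_mesh (hδ : 0 < δ) (γ : SAW.DomainSAW Ω δ a b) {ε ℓ : ℝ} (hεδ : ε < δ)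
    (hεℓ : ε < ℓ) :
    ¬ ∃ s t u : unitInterval, s < t ∧ t < u ∧
      dist ((⟨γ.walk.toCurve (meshPoint δ)⟩ : Curve ℂ) s) ((⟨γ.walk.toCurve (meshPoint δ)⟩ : Curve ℂ) u) ≤ ε ∧
      ℓ ≤ dist ((⟨γ.walk.toCurve (meshPoint δ)⟩ : Curve ℂ) s) ((⟨γ.walk.toCurve (meshPoint δ)⟩ : Curve ℂ) t) := by
  rintro ⟨s, t, u, hst, htu, hsu, hfar⟩
  have hsu' : dist (γ.walk.toCurve (meshPoint δ) s) (γ.walk.toCurve (meshPoint δ) u) ≤ ε := hsu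
  have hfar' : ℓ ≤ dist (γ.walk.toCurve (meshPoint δ) s) (γ.walk.toCurve (meshPoint δ) t) := hfar
  have h := dist_toCurve_le_of_dist_lt hδ γ hst.le htu.le (hsu'.trans_lt hεδ)
  exact (lt_irrefl ℓ) ((hfar'.trans (h.trans hsu')).trans_lt hεℓ)

end Saw

end NoSubmeshFjord

/-- **Registered stub `sawPolyline_noSubmeshFjord`** (crux stmt-CriticalPhenomena-1372, line `Sketch`, lead c9):
self-avoiding lattice polylines have no sub-mesh fjords — for `ε < δ` and `ε < ℓ` no times `s < t < u` have the
ends `ε`-close and the middle `ℓ`-far (`NoSubmeshFjord.not_exists_fjord_of_lt_mesh`). [folklore] -/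
theorem sawPolyline_noSubmeshFjord : ∀ {Ω : Set ℂ} {δ : ℝ} {a b : Site 2}, 0 < δ → ∀ (γ : SAW.DomainSAW Ω δ a b) {ε ℓ : ℝ}, ε < δ → ε < ℓ → ¬ ∃ s t u : unitInterval, s < t ∧ t < u ∧ dist ((⟨γ.walk.toCurve (meshPoint δ)⟩ : Curve ℂ) s) ((⟨γ.walk.toCurve (meshPoint δ)⟩ : Curve ℂ) u) ≤ ε ∧ ℓ ≤ dist ((⟨γ.walk.toCurve (meshPoint δ)⟩ : Curve ℂ) s) ((⟨γ.walk.toCurve (meshPoint δ)⟩ : Curve ℂ) t) :=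
  fun hδ γ _ _ hεδ hεℓ => NoSubmeshFjord.not_exists_fjord_of_lt_mesh hδ γ hεδ hεℓ

end Summit.CriticalPhenomena.SAWScalingLimit.Theorems

end
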